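import Summits.HodgeConjecture.HodgeConjecture.Theorems.F0P3bInducedCharTransferLeviIntegrand   -- ★ (P) `leviIntegrand_eq_signed` (the ξ-family case) and its whole ★ import cone: (L2)(L3) dictionaries, S3-A, S3-B
import HarnessLib

/-!
# R90-TF · S3 · THEOREMS — `R90S3LeviIntegrandSignedOfDictionary` (WAVE 5, brick (W5-a) part A): Lemma 4.9.2 on the Levi stratum of an inner form,
# the SIGNED integrand identity for ARBITRARY torus characters `(χ₂, χ₁; χ̃)` related by the dictionary `χ₂(g)·χ₁(u)·τ_v(γ_H) = χ̃(ι_v γ_H)`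

R90-TF section S3 = [Rogawski1990] Ch. 12 ∕ §4.9 ∕ §4.13 (successor dealer R90-C12-plan (g2), DEAL S3 WAVE 5 «L. 4.9.2 SIGNED AT GENERAL (χ₂, χ₁)»,
memo `R90/R90-C12-plan/g2/DEAL-S3-WAVE5-L492General.md` 21f0895c611a62a3); crux H413 (`stmt-HodgeConjecture-24833`, lane `--supports … --as helper`), route
`HCCMUnconditional`; hand (W5-a) K2E3-p21 (g9), part A of two (the 400-line rule).  THEOREMS ONLY (no `def`, no `instance`, no notation, no named fact,
no `sorry`); never imports `Cruxes/…/Lines`.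

WHAT.  ★ `leviIntegrand_eq_signed` (F0P3b-p01 (g7)) proves the pointwise identity of Lemma 4.9.2 on the Levi stratum, `Φ_H(γ_H) = ε_v(H) · Φ_G(ι_v γ_H)`, for
the ξ-FAMILY of characters (`χ_{H,2} = torusCharPair … 0 ((η ∘ quotConj)·‖·‖^{1∕2}) ψ`, `χ_{H,1} = ψ ∘ det`, `χ_G = cmXiTorusChar L v μ_v η ψ`).  Its proof uses the
characters through exactly ONE step, the dictionary (L2) ★ `torusCharPair_mul_localDet_mul_finTau_eq_cmXiTorusChar`; everything else (★ S3-A one-term transfer on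
the stratum, ★ S3-B `Δ‴ = τ_v · D_{G∕H,v} · ε`, ★ (L3) Jacobians) is character-free.  This file re-runs that proof with the characters as VARIABLES and (L2) as a
HYPOTHESIS `e1`:
* **`leviIntegrand_eq_signed_of_dictionary`** — for `χ₂ : T₂ →* ℂˣ`, `χ₁ : U(Φ₁)_v →* ℂˣ`, `χ̃ : T₃ →* ℂˣ` with `χ₂(g)·χ₁(u)·finTau L v γ_H μ = χ̃(⟨ι_v γ_H, _⟩)`
  at the stratum point `γ_H`, the signed integrand identity (`hμ : IsQuadraticCharExtension …` of ★ (P) is not needed here — it only fed (L2)).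
Part B (`Theorems/R90S3InducedCharTransferSignedGeneral`) builds `χ̃` by transport and integrates, giving Lemma 4.9.2 SIGNED for every `(χ₂, χ₁)`.

HONEST LABEL: HC_CM is proved only modulo the 7 printed citations (2 remaining named inputs: hLiu418 = stmt-HodgeConjecture-24832, h413 =
stmt-HodgeConjecture-24833) until rung 0 closes; a pointwise identity on the Levi stratum, pays no socket by itself; count-neutral helper.

## References
* [Rogawski1990] J. D. Rogawski, *Automorphic Representations of Unitary Groups in Three Variables*, Ann. of Math. Stud. 123 (1990): §4.9 Lemma 4.9.2,
  Prop. 4.9.1 pp. 55–56; §12.1 p. 171; §14.6 p. 242.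
-/

set_option autoImplicit false
-- the mandated namespace repeats the single-problem summit's segment (`HodgeConjecture.HodgeConjecture`)
set_option linter.dupNamespace false

noncomputable section

open MeasureTheory Measure Set NumberField IsDedekindDomain Matrix
open Literature.NumberTheory.Automorphic Literature.NumberTheory.Automorphic.UnitaryGroup
open Literature.NumberTheory.GaloisRepresentations Literature.NumberTheory.Rogawski1990
open scoped NNReal Matrix MatrixGroups

namespace Summit.HodgeConjecture.HodgeConjecture.R90.S3

open Summit.HodgeConjecture.HodgeConjecture.Cruxes.H413.F0P3bInducedCharTransferLeviDictionary

variable (L : Type) [Field L] [NumberField L] [IsCMField L]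

/-- `((if P then 1 else −1 : ℤ) : ℂ) = if P then 1 else −1` (cast of the sign token of ★ S3-B). [cite: Rogawski1990, §14.6 p. 242] -/
private theorem int_cast_ite_one_neg_one (P : Prop) [Decidable P] : (((if P then 1 else -1 : ℤ)) : ℂ) = if P then (1 : ℂ) else -1 := by
  split_ifs <;> simp

set_option maxHeartbeats 400000 in -- the statement alone is ≈ 60 lines of tokens: each `rw`∕`simp only` pass over the goal costs ≈ 10⁵ heartbeats (measured: fails at 2·10⁵, passes at 4·10⁵)
open scoped Classical in
/-- **LEMMA 4.9.2 ON THE LEVI STRATUM OF AN INNER FORM — THE SIGNED INTEGRAND IDENTITY, FOR ANY TORUS CHARACTERS RELATED BY THE DICTIONARY.**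
The statement of ★ `F0P3bInducedCharTransferLeviIntegrand.leviIntegrand_eq_signed` with the ξ-family `(χ_{H,2}, ψ ∘ det, χ_ξ)` replaced by ARBITRARY characters
`χ₂` of the torus `T₂ ⊆ U(Φ₂)_v`, `χ₁` of `U(Φ₁)_v` and `χ̃` of the torus `T₃ ⊆ U(Φ₃)_v`, and the character dictionary (L2) «`χ₂(g) · χ₁(u) · τ_v(γ_H) = χ̃(ι_v γ_H)`» at the
point `γ_H = (diag(d′₀, d′₁), u)` taken as the HYPOTHESIS `e1` (for the ξ-family it is ★ `torusCharPair_mul_localDet_mul_finTau_eq_cmXiTorusChar`; for a general pair it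
holds BY CONSTRUCTION of `χ̃` through the torus transport ★ `exists_leviTorus_continuousMulEquiv`, see `Theorems/R90S3InducedCharTransferSignedGeneral`).  For a
`Δ‴_v`-matched test pair `(f^H, f)` and `γ_H` `G`-regular on the stratum:
`χ₂(g) · χ₁(u) · δ_{B₂}^{1∕2}(g) · √‖b − 1‖ · O^H_{γ_H}(f^H) = ε · (χ̃(ι_v γ_H) · δ_B^{1∕2}(ι_v γ_H) · (‖a − 1‖·√‖b − 1‖) · O_{e(ι_v γ_H)}(f))`, `ε = +1` iff the frame
multiplier `a` is a norm.  Proof = ★ S3-A (one term) + ★ S3-B (`Δ‴ = τ·D·ε`) + `e1` + ★ (L3), one `linear_combination` — ★ (P)'s proof verbatim, character-agnostic.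
[cite: Rogawski1990, §4.9 Lemma 4.9.2 p. 56; Prop. 4.9.1 p. 55; §12.1 p. 171; §14.6 p. 242] -/
theorem leviIntegrand_eq_signed_of_dictionary (H : Matrix (Fin 3) (Fin 3) L) (hH : (H.map (IsCMField.complexConj L))ᵀ = H) (hHd : IsUnit H.det)
    {v : HeightOneSpectrum (𝓞 ↥(maximalRealSubfield L))} (w : UnitaryGroup.PlacesOver L v) (hw : IsCMField.complexConj L • w.1 = w.1)
    (T₀ : GL (Fin 3) (UnitaryGroup.LocalRing L v)) {a : UnitaryGroup.LocalRing L v} (ha₀ : IsUnit a)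
    (h : formCongr (conjLocal L (IsCMField.complexConj L) v) T₀ (H.map (algebraMap L (UnitaryGroup.LocalRing L v))) =
      a • (Matrix.of fun i j : Fin 3 => if i.val + j.val + 1 = 3 then (1 : L) else 0).map (algebraMap L (UnitaryGroup.LocalRing L v)))
    [∀ γ : ((cmDatum L 3 H).Local v), MeasurableSpace (((cmDatum L 3 H).Local v) ⧸ Subgroup.centralizer ({γ} : Set ((cmDatum L 3 H).Local v)))]
    [∀ a : ((cmDatum L 2 (Matrix.of fun i j : Fin 2 => if i.val + j.val + 1 = 2 then (1 : L) else 0)).Local v ×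
      (cmDatum L 1 (Matrix.of fun i j : Fin 1 => if i.val + j.val + 1 = 1 then (1 : L) else 0)).Local v),
      MeasurableSpace (((cmDatum L 2 (Matrix.of fun i j : Fin 2 => if i.val + j.val + 1 = 2 then (1 : L) else 0)).Local v ×
      (cmDatum L 1 (Matrix.of fun i j : Fin 1 => if i.val + j.val + 1 = 1 then (1 : L) else 0)).Local v) ⧸ Subgroup.centralizer ({a} : Set ((cmDatum L 2 (Matrix.of fun i j : Fin 2 => if i.val + j.val + 1 = 2 then (1 : L) else 0)).Local v ×
      (cmDatum L 1 (Matrix.of fun i j : Fin 1 => if i.val + j.val + 1 = 1 then (1 : L) else 0)).Local v)))]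
    (μ : HeckeCharacter L)
    (hl : ∀ (v : HeightOneSpectrum (𝓞 ↥(maximalRealSubfield L)))
      (a : (cmDatum L 2 (Matrix.of fun i j : Fin 2 => if i.val + j.val + 1 = 2 then (1 : L) else 0)).Local v ×
      (cmDatum L 1 (Matrix.of fun i j : Fin 1 => if i.val + j.val + 1 = 1 then (1 : L) else 0)).Local v)
      (b : (cmDatum L 3 H).Local v)
      (x : (cmDatum L 2 (Matrix.of fun i j : Fin 2 => if i.val + j.val + 1 = 2 then (1 : L) else 0)).Local v ×
      (cmDatum L 1 (Matrix.of fun i j : Fin 1 => if i.val + j.val + 1 = 1 then (1 : L) else 0)).Local v),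
      finExplicitDelta L v H (x * a * x⁻¹) μ b = finExplicitDelta L v H a μ b)
    (hr : ∀ (v : HeightOneSpectrum (𝓞 ↥(maximalRealSubfield L)))
      (a : (cmDatum L 2 (Matrix.of fun i j : Fin 2 => if i.val + j.val + 1 = 2 then (1 : L) else 0)).Local v ×
      (cmDatum L 1 (Matrix.of fun i j : Fin 1 => if i.val + j.val + 1 = 1 then (1 : L) else 0)).Local v)
      (b y : (cmDatum L 3 H).Local v),
      finExplicitDelta L v H a μ (y * b * y⁻¹) = finExplicitDelta L v H a μ b)
    (χ₂ : ↥(torusU (conjLocal L (IsCMField.complexConj L) v) (cmLocalForm L 2 v)) →* ℂˣ)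
    (χ₁ : (cmDatum L 1 (Matrix.of fun i j : Fin 1 => if i.val + j.val + 1 = 1 then (1 : L) else 0)).Local v →* ℂˣ)
    (χt : ↥(torusU (conjLocal L (IsCMField.complexConj L) v) (cmLocalForm L 3 v)) →* ℂˣ)
    (mH : OrbitalMeasureFamily ((cmDatum L 2 (Matrix.of fun i j : Fin 2 => if i.val + j.val + 1 = 2 then (1 : L) else 0)).Local v ×
      (cmDatum L 1 (Matrix.of fun i j : Fin 1 => if i.val + j.val + 1 = 1 then (1 : L) else 0)).Local v)) (mG : OrbitalMeasureFamily ((cmDatum L 3 H).Local v))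
    {fH : ((cmDatum L 2 (Matrix.of fun i j : Fin 2 => if i.val + j.val + 1 = 2 then (1 : L) else 0)).Local v ×
      (cmDatum L 1 (Matrix.of fun i j : Fin 1 => if i.val + j.val + 1 = 1 then (1 : L) else 0)).Local v) → ℂ}
    {f : (cmDatum L 3 H).Local v → ℂ} (htr : IsLocalDeltaTransfer L H v (finExplicitCollection L H μ hl hr v) mH mG fH f)
    {γH : ((cmDatum L 2 (Matrix.of fun i j : Fin 2 => if i.val + j.val + 1 = 2 then (1 : L) else 0)).Local v ×
      (cmDatum L 1 (Matrix.of fun i j : Fin 1 => if i.val + j.val + 1 = 1 then (1 : L) else 0)).Local v)}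
    {d' : Fin 2 → (UnitaryGroup.LocalRing L v)ˣ} (hd' : glDiagonal 2 (UnitaryGroup.LocalRing L v) d' = (γH.1.val : GL (Fin 2) (UnitaryGroup.LocalRing L v)))
    (hreg : IsLocalGRegular L v γH)
    (ha : IsUnit ((((d' 0)⁻¹ * (isUnit_finGammaTwo L v γH).unit : (UnitaryGroup.LocalRing L v)ˣ) : UnitaryGroup.LocalRing L v) - 1))
    (hb : IsUnit ((((d' 0)⁻¹ * d' 1 : (UnitaryGroup.LocalRing L v)ˣ) : UnitaryGroup.LocalRing L v) - 1))
    (hreg' : ∀ i j : Fin 3, i ≠ j → IsUnit (((![d' 0, (isUnit_finGammaTwo L v γH).unit, d' 1] i : (UnitaryGroup.LocalRing L v)ˣ) : UnitaryGroup.LocalRing L v) -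
      ((![d' 0, (isUnit_finGammaTwo L v γH).unit, d' 1] j : (UnitaryGroup.LocalRing L v)ˣ) : UnitaryGroup.LocalRing L v)))
    (e1 : ((χ₂ ⟨(γH.1 : ↥(unitaryGroupOfForm (conjLocal L (IsCMField.complexConj L) v) (cmLocalForm L 2 v))), fst_mem_torusU_of_glDiagonal_eq L v hd'⟩ : ℂˣ) : ℂ) *
        ((χ₁ γH.2 : ℂˣ) : ℂ) * finTau L v γH μ =
      ((χt ⟨(endoEmbLocal L v γH : ↥(unitaryGroupOfForm (conjLocal L (IsCMField.complexConj L) v) (cmLocalForm L 3 v))),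
          endoEmbLocal_mem_torusU_of_endoEmbLocal_eq L v γH (endoEmbLocal_eq_glDiagonal_of_fst_eq L v γH hd')⟩ : ℂˣ) : ℂ)) :
    ((χ₂
          ⟨(γH.1 : ↥(unitaryGroupOfForm (conjLocal L (IsCMField.complexConj L) v) (cmLocalForm L 2 v))), fst_mem_torusU_of_glDiagonal_eq L v hd'⟩ : ℂˣ) : ℂ) *
        ((χ₁ γH.2 : ℂˣ) : ℂ) *
        (haveI := locallyCompactSpace_cmBorelU L 2 v;
          ((rootDeltaChar (cmBorelTriple L 2 v).P
              ⟨(γH.1 : ↥(unitaryGroupOfForm (conjLocal L (IsCMField.complexConj L) v) (cmLocalForm L 2 v))),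
                torusU_le_borelU _ _ (fst_mem_torusU_of_glDiagonal_eq L v hd')⟩ : ℂˣ) : ℂ)) *
        (((NNReal.sqrt (unitModulusChar (UnitaryGroup.LocalRing L v) hb.unit) : ℝ≥0) : ℝ) : ℂ) *
        classOrbitalIntegral mH fH (ConjClasses.mk γH) =
      (if ∃ z : UnitaryGroup.LocalRing L v, IsUnit z ∧ a = z * conjLocal L (IsCMField.complexConj L) v z then (1 : ℂ) else -1) *
        (((χt
              ⟨(endoEmbLocal L v γH : ↥(unitaryGroupOfForm (conjLocal L (IsCMField.complexConj L) v) (cmLocalForm L 3 v))),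
                endoEmbLocal_mem_torusU_of_endoEmbLocal_eq L v γH (endoEmbLocal_eq_glDiagonal_of_fst_eq L v γH hd')⟩ : ℂˣ) : ℂ) *
          (haveI := locallyCompactSpace_cmBorelU L 3 v;
            ((rootDeltaChar (cmBorelTriple L 3 v).P
                ⟨(endoEmbLocal L v γH : ↥(unitaryGroupOfForm (conjLocal L (IsCMField.complexConj L) v) (cmLocalForm L 3 v))),
                  torusU_le_borelU _ _ (endoEmbLocal_mem_torusU_of_endoEmbLocal_eq L v γH (endoEmbLocal_eq_glDiagonal_of_fst_eq L v γH hd'))⟩ : ℂˣ) : ℂ)) *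
          (((unitModulusChar (UnitaryGroup.LocalRing L v) ha.unit * NNReal.sqrt (unitModulusChar (UnitaryGroup.LocalRing L v) hb.unit) : ℝ≥0) : ℝ) : ℂ) *
          classOrbitalIntegral mG f (ConjClasses.mk (cmDatumLocalCongr L v T₀ ha₀ h (endoEmbLocal L v γH)))) := by
  have hι := endoEmbLocal_eq_glDiagonal_of_fst_eq L v γH hd'
  -- `u − d′₁` is a unit (the pair `(1, 2)` of `d = (d′₀, u, d′₁)`)
  have h12 : IsUnit (finGammaTwo L v γH - (d' 1 : UnitaryGroup.LocalRing L v)) := by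
    have h := hreg' 1 2 (by decide)
    simp only [Matrix.cons_val_one, Matrix.cons_val_two, Matrix.head_cons, Matrix.tail_cons] at h
    exact h
  -- S3-A: one term; S3-B: `Δ‴ = τ · D · ε`
  rw [classOrbitalIntegral_eq_delta_mul_classOrbitalIntegral_of_levi_cmDatumLocalCongr L H hH hHd T₀ ha₀ h (finExplicitCollection L H μ hl hr v) mH mG htr
      hd' hreg ha hb h12]
  simp only [finExplicitCollection_Δ]   -- (`rw` here times out: kabstract on the structure projection)
  rw [finExplicitDelta_cmDatumLocalCongr_endoEmbLocal_eq L H w hw T₀ ha₀ h μ γH hι hreg', int_cast_ite_one_neg_one]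
  -- (L2) and (L3)
  have e2 := rootDeltaChar_two_mul_sqrt_mul_finWeylRatio_eq L v γH hd' ha hb
  linear_combination
    ((haveI := locallyCompactSpace_cmBorelU L 2 v;
        ((rootDeltaChar (cmBorelTriple L 2 v).P
            ⟨(γH.1 : ↥(unitaryGroupOfForm (conjLocal L (IsCMField.complexConj L) v) (cmLocalForm L 2 v))),
              torusU_le_borelU _ _ (fst_mem_torusU_of_glDiagonal_eq L v hd')⟩ : ℂˣ) : ℂ)) *
      (((NNReal.sqrt (unitModulusChar (UnitaryGroup.LocalRing L v) hb.unit) : ℝ≥0) : ℝ) : ℂ) * (finWeylRatio L v γH : ℂ) *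
      (if ∃ z : UnitaryGroup.LocalRing L v, IsUnit z ∧ a = z * conjLocal L (IsCMField.complexConj L) v z then (1 : ℂ) else -1) *
      classOrbitalIntegral mG f (ConjClasses.mk (cmDatumLocalCongr L v T₀ ha₀ h (endoEmbLocal L v γH)))) * e1 +
    ((if ∃ z : UnitaryGroup.LocalRing L v, IsUnit z ∧ a = z * conjLocal L (IsCMField.complexConj L) v z then (1 : ℂ) else -1) *
      ((χt
          ⟨(endoEmbLocal L v γH : ↥(unitaryGroupOfForm (conjLocal L (IsCMField.complexConj L) v) (cmLocalForm L 3 v))),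
            endoEmbLocal_mem_torusU_of_endoEmbLocal_eq L v γH (endoEmbLocal_eq_glDiagonal_of_fst_eq L v γH hd')⟩ : ℂˣ) : ℂ) *
      classOrbitalIntegral mG f (ConjClasses.mk (cmDatumLocalCongr L v T₀ ha₀ h (endoEmbLocal L v γH)))) * e2

end Summit.HodgeConjecture.HodgeConjecture.R90.S3

end
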